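/-
Origin: expansion seat `planner-pub-hodgecm-pv02-g6-0`, handover #3 v2 2026-08-18T10:07:36Z doc-only (`HOME/pub-hodgecm-pv02-g6/lean/Pv02g6/ArchAWeilKFiniteCriterion.lean`, md5 bf2f773d, 161 lines);
landed by the gen-7 packager in gate run 28 REPLACES the earlier landed copy of `HodgeCM/PerL34/ArchAWeilKFiniteCriterion.lean` (import ^import Pv[0-9]+g[0-9]+\.→import HodgeCM.PerL34. ×1).
-/
/-
Origin: HOME/pub-hodgecm-pv02-g6/lean/Pv02g6/ArchAWeilKFiniteCriterion.lean (module `Pv02g6.ArchAWeilKFiniteCriterion`; the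
packager renames to `HodgeCM.PerL34.ArchAWeilKFiniteCriterion` and rewrites `import Pv02g6.ArchAWeilKFinite` ↦
`import HodgeCM.PerL34.ArchAWeilKFinite`) — session planner-pub-hodgecm-pv02-g6-0 (unit pub-hodgecm-pv02-g6, DAG-NODE
PROVER #02 gen 6).  DAG node (HOME/LEMMAS.md v14 §1): N27 = PerL v5 Lemma 4.1(a) `lem:arch` — the index space of the
`K`-finite sub-model `WeilThetaModel.kFinite` (this seat's #1) characterised by [BW] VIII 2.7(1)'s notion verbatim.
v2 (DOC-ONLY, adv2g22-C57): module docstring cites ll. 265–268 / l. 341; Lean code byte-identical to v1 7c02b6af18be.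
-/
import Summits.HodgeConjecture.HodgeCM.PerL34.ArchAWeilKFinite

/-!
# The `K`-finite index space `finiteSK M ι` = "θ_Φ is a finite sum of integer-weight kernels at every real place"

#1 (`ArchAWeilKFinite`) cut the index space of a Weil theta model `M` down to
`finiteSK M ι = {Φ ∈ M.SK | ∀ b, FiniteDimensional ℂ (orbitSpan M ι b Φ)}` ("`K`-finiteness read on kernels",
pv02-g5 `OrbitFinite`; DEFINITIONAL for the vectors L4.1(a) is applied to in print — the Fock = `K`-finite vectors of
l. 264 whose lifts span the theta space of ll. 265–268; NOT for all of `𝒮^κ`, which from l. 341 on sits in the full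
Schwartz–Bruhat space, adv2g22-C57).  [BW] VIII 2.7(1) (PDF p0197) phrases `K`-finiteness as: every vector is a FINITE SUM OF WEIGHT
VECTORS of the compact torus, with (integer) characters `u ↦ u^k`.  THIS FILE proves the two phrasings agree on kernels,
so that a MODEL BUILDER (prl1-g5 / pv09-g5 / pv06: an instance of `WeilThetaModel` over the genuine torus, GAPS
carverg2-X1) can certify `M.kFinite ι = M` — i.e. use `N27_genuine` (#2) for ALL of `M.SK` — by exhibiting weight
decompositions, and conversely sees exactly what membership in `finiteSK` buys:

* `orbitSpan_le_span_of_weightSum` / **`finiteDimensional_orbitSpan_of_weightSum`** — if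
  `θ_Φ = ∑_{a ∈ α} F_a` (any finite index type `α`) with `T_{ι_b(u)} F_a = u^{k_a} • F_a` for all `u ∈ U(W_{i,b})`, then the
  `U(W_{i,b})`-orbit span of `θ_Φ` lies in `span {F_a}` and is finite-dimensional (pure algebra, no continuity);
* **`mem_finiteSK_of_weightSum`** — hence such a `Φ` (at every real place `b`) lies in `finiteSK M ι`;
  **`orbitFinite_of_kernelWeightDecomposition`** / **`finiteSK_eq_SK_of_kernelWeightDecomposition`** — in particular
  pv02-g5's PRINT-labelled `KernelWeightDecomposition M ι` (`ArchAWeil`, run 26) implies `OrbitFinite M ι` and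
  `finiteSK M ι = M.SK` (the remark "strictly weaker" of `ArchAWeilFinite`'s header, made a theorem);
* **`exists_weightSum_of_finiteDimensional`** — conversely, if `ι_b` is continuous and the orbit span of `θ_Φ` is
  finite-dimensional, then `θ_Φ = ∑_{k ∈ s} F_k` for a finite set `s ⊂ ℤ` of weights and kernels `F_k` IN THE ORBIT SPAN with
  `T_{ι_b(u)} F_k = u^k • F_k` (pv02-g5's kernel theorem `CircleWeights.iSup_weightSpace_eq_top` = [BW] VIII 2.7(1) for `U(1)`,
  unpacked into a finite sum);
* **`mem_finiteSK_iff_weightSum (hι : ∀ b, Continuous (ι b))`** — the characterisation: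
  `Φ ∈ finiteSK M ι ↔ ∀ b, ∃ (s : Finset ℤ) (F : ℤ → kernels), (∀ k u, T_{ι_b(u)} (F k) = u^k • F k) ∧ θ_Φ = ∑_{k ∈ s} F k`.

No Prop hypothesis other than the displayed ones; nothing cited; no PerL/QW8/2001 statement is a hypothesis.
-/

set_option autoImplicit false

noncomputable section

open Module Module.End

namespace HodgeCM
namespace PerL34
namespace ArchAWeil

variable {GU : Type} [Group GU] [TopologicalSpace GU] [IsTopologicalGroup GU] {ΓU : Subgroup GU}
variable {G : Type} [CommGroup G] [TopologicalSpace G] [IsTopologicalGroup G] {Γ : Subgroup G}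
variable (M : WeilThetaModel GU ΓU G Γ) {RealPl : Type} (ι : RealPl → (Circle →* G))

/-! ## §1  Weight sums ⇒ finite-dimensional orbit span (algebra only) -/

/-- If `θ_Φ = ∑ₐ Fₐ` with each `Fₐ` a `U(W_{i,b})`-weight kernel, the orbit span of `θ_Φ` lies in `span {Fₐ}`. -/
theorem orbitSpan_le_span_of_weightSum {α : Type*} [Fintype α] (b : RealPl) (Φ : M.SK)
    (F : α → C((GU ⧸ ΓU) × (G ⧸ Γ), ℂ)) (k : α → ℤ)
    (hw : ∀ a (u : Circle), transl (ι b u) (F a) = ((u : ℂ) ^ k a) • F a) (hsum : M.θ Φ = ∑ a, F a) :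
    orbitSpan M ι b Φ ≤ Submodule.span ℂ (Set.range F) := by
  refine Submodule.span_le.mpr ?_
  rintro _ ⟨u, rfl⟩
  change M.θ (M.omg (ι b u) Φ) ∈ Submodule.span ℂ (Set.range F)
  rw [← transl_θ, hsum, map_sum]
  refine Submodule.sum_mem _ fun a _ => ?_
  rw [hw a u]
  exact Submodule.smul_mem _ _ (Submodule.subset_span ⟨a, rfl⟩)

/-- **Weight sums give finite-dimensional orbit spans.** -/
theorem finiteDimensional_orbitSpan_of_weightSum {α : Type*} [Fintype α] (b : RealPl) (Φ : M.SK)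
    (F : α → C((GU ⧸ ΓU) × (G ⧸ Γ), ℂ)) (k : α → ℤ)
    (hw : ∀ a (u : Circle), transl (ι b u) (F a) = ((u : ℂ) ^ k a) • F a) (hsum : M.θ Φ = ∑ a, F a) :
    FiniteDimensional ℂ (orbitSpan M ι b Φ) :=
  haveI : FiniteDimensional ℂ (Submodule.span ℂ (Set.range F)) :=
    FiniteDimensional.span_of_finite ℂ (Set.finite_range F)
  Submodule.finiteDimensional_of_le (orbitSpan_le_span_of_weightSum M ι b Φ F k hw hsum)

/-- **A `Φ` whose kernel is a finite sum of integer-weight kernels at every real place is `K`-finite**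
(lies in the index space of `M.kFinite ι`). -/
theorem mem_finiteSK_of_weightSum (Φ : M.SK)
    (h : ∀ b : RealPl, ∃ (n : ℕ) (F : Fin n → C((GU ⧸ ΓU) × (G ⧸ Γ), ℂ)) (k : Fin n → ℤ),
      (∀ j (u : Circle), transl (ι b u) (F j) = ((u : ℂ) ^ k j) • F j) ∧ M.θ Φ = ∑ j, F j) :
    (Φ : M.W.SX) ∈ M.finiteSK ι := by
  refine (M.mem_finiteSK_iff ι Φ).mpr fun b => ?_
  obtain ⟨n, F, k, hw, hsum⟩ := h b
  exact finiteDimensional_orbitSpan_of_weightSum M ι b Φ F k hw hsum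

/-- **pv02-g5's PRINT-labelled `KernelWeightDecomposition` implies the DEFINITIONAL `OrbitFinite`.** -/
theorem orbitFinite_of_kernelWeightDecomposition (h : KernelWeightDecomposition M ι) : OrbitFinite M ι := by
  intro b Φ
  obtain ⟨n, Ψ, k, hsum, hΨ⟩ := h b Φ
  refine finiteDimensional_orbitSpan_of_weightSum M ι b Φ (fun j => M.θ (Ψ j)) k (fun j u => ?_) hsum
  rw [transl_θ]
  exact hΨ j u

/-- Under `KernelWeightDecomposition M ι` the `K`-finite sub-model has the SAME index space as `M`. -/
theorem finiteSK_eq_SK_of_kernelWeightDecomposition (h : KernelWeightDecomposition M ι) : M.finiteSK ι = M.SK :=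
  M.finiteSK_eq_of_orbitFinite ι (orbitFinite_of_kernelWeightDecomposition M ι h)

/-! ## §2  Finite-dimensional orbit span ⇒ weight sum (uses continuity of `ι_b`) -/

variable [CompactSpace (GU ⧸ ΓU)] [CompactSpace (G ⧸ Γ)]

/-- **A kernel with finite-dimensional `U(W_{i,b})`-orbit span is a finite sum of integer-weight kernels taken from
that orbit span** ([BW] VIII 2.7(1) for `U(1)`: pv02-g5's `CircleWeights.iSup_weightSpace_eq_top`, unpacked). -/
theorem exists_weightSum_of_finiteDimensional {b : RealPl} (hι : Continuous (ι b)) (Φ : M.SK)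
    (hfin : FiniteDimensional ℂ (orbitSpan M ι b Φ)) :
    ∃ (s : Finset ℤ) (F : ℤ → C((GU ⧸ ΓU) × (G ⧸ Γ), ℂ)),
      (∀ k, F k ∈ orbitSpan M ι b Φ) ∧ (∀ k (u : Circle), transl (ι b u) (F k) = ((u : ℂ) ^ k) • F k) ∧
        M.θ Φ = ∑ k ∈ s, F k := by
  haveI := hfin
  have hcont : ∀ x : orbitSpan M ι b Φ, Continuous fun u => orbitRep M ι b Φ u x := fun x =>
    (continuous_transl_apply (ΓU := ΓU) (Γ := Γ) hι x.1).subtype_mk fun u =>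
      transl_mem_orbitSpan M ι b Φ u x.2
  have htop := CircleWeights.iSup_weightSpace_eq_top (orbitRep M ι b Φ) hcont
  have hx : (⟨M.θ Φ, θ_mem_orbitSpan M ι b Φ⟩ : orbitSpan M ι b Φ) ∈
      ⨆ k, CircleWeights.weightSpace (orbitRep M ι b Φ) k := by
    rw [htop]; exact Submodule.mem_top
  obtain ⟨s, hs⟩ := Submodule.mem_iSup_iff_exists_finset.mp hx
  obtain ⟨μ, hμ⟩ := (Submodule.mem_iSup_finset_iff_exists_sum _ _).mp hs
  refine ⟨s, fun k => ((μ k : orbitSpan M ι b Φ) : C((GU ⧸ ΓU) × (G ⧸ Γ), ℂ)), fun k => (μ k : orbitSpan M ι b Φ).2,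
    fun k u => ?_, ?_⟩
  · have hk := congrArg Subtype.val ((CircleWeights.mem_weightSpace_iff _ _ _).mp (μ k).2 u)
    rw [coe_orbitRep_apply, Submodule.coe_smul] at hk
    exact hk
  · have hv := congrArg Subtype.val hμ
    rw [Submodule.coe_sum] at hv
    exact hv.symm

/-- **The characterisation of the `K`-finite index space** (continuity of the real-place circles assumed):
`Φ ∈ finiteSK M ι` iff at every real place `θ_Φ` is a finite sum of integer-weight kernels — [BW] VIII 2.7(1)'s
phrasing of `K`-finiteness, verbatim on kernels. -/
theorem mem_finiteSK_iff_weightSum (hι : ∀ b, Continuous (ι b)) (Φ : M.SK) :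
    (Φ : M.W.SX) ∈ M.finiteSK ι ↔
      ∀ b : RealPl, ∃ (s : Finset ℤ) (F : ℤ → C((GU ⧸ ΓU) × (G ⧸ Γ), ℂ)),
        (∀ k (u : Circle), transl (ι b u) (F k) = ((u : ℂ) ^ k) • F k) ∧ M.θ Φ = ∑ k ∈ s, F k := by
  rw [M.mem_finiteSK_iff ι Φ]
  refine ⟨fun h b => ?_, fun h b => ?_⟩
  · obtain ⟨s, F, -, hw, hsum⟩ := exists_weightSum_of_finiteDimensional M ι (hι b) Φ (h b)
    exact ⟨s, F, hw, hsum⟩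
  · obtain ⟨s, F, hw, hsum⟩ := h b
    refine finiteDimensional_orbitSpan_of_weightSum M ι b Φ (fun k : s => F k) (fun k => (k : ℤ))
      (fun k u => hw k u) ?_
    rw [hsum, ← Finset.sum_coe_sort]

/-- `OrbitFinite M ι` iff EVERY `Φ ∈ M.SK` has weight sums at every real place (given continuity of the circles) —
pv02-g5's DEFINITIONAL hypothesis and [BW] VIII 2.7(1)'s phrasing coincide on kernels. -/
theorem orbitFinite_iff_weightSum (hι : ∀ b, Continuous (ι b)) :
    OrbitFinite M ι ↔
      ∀ (b : RealPl) (Φ : M.SK), ∃ (s : Finset ℤ) (F : ℤ → C((GU ⧸ ΓU) × (G ⧸ Γ), ℂ)),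
        (∀ k (u : Circle), transl (ι b u) (F k) = ((u : ℂ) ^ k) • F k) ∧ M.θ Φ = ∑ k ∈ s, F k := by
  refine ⟨fun h b Φ => ?_, fun h b Φ => ?_⟩
  · exact ((mem_finiteSK_iff_weightSum M ι hι Φ).mp ((M.mem_finiteSK_iff ι Φ).mpr fun b => h b Φ)) b
  · exact ((M.mem_finiteSK_iff ι Φ).mp ((mem_finiteSK_iff_weightSum M ι hι Φ).mpr fun b => h b Φ)) b

end ArchAWeil
end PerL34
end HodgeCM

end
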